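import Mathlib
import HarnessLib
import Summits.AtomisticToContinuum.BoseEinsteinCondensation.Theorems.NumberPhaseSandwichNearPivotCompare

/-! # NumberPhaseSandwich · the near-pivot fluctuation floor from local statistics — part 2 of 2 (the registered statements VERBATIM and `stub_nearPivot_of_kinematic`)

KERNEL PROOF of the registered stub `stub_nearPivot_of_kinematic : ShellFloorP → PairMixedMomentP →
PairSecondMomentP → StubNearPivot` of line «kinematic-near-pivot» (crux `FluctuationFloor`,
stmt-AtomisticToContinuum-32638, route NumberPhaseSandwich; decomp-a2c lens-6 g10): the kinematic (uncertainty)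
floor `⟨|∇G|²⟩² ≤ Var_Ψ(G)·(2‖∇G·∇Ψ‖ + ‖ΔG Ψ‖)²` (`NumberPhaseSandwichKinematicFloor.kinematic_floor`) for the dressed
pair generator `G = Σ_p (h_c − h_c')(x_p)` combined with the bump calculus (`NumberPhaseSandwichBumpCalculus`:
`|∇G|² ≥ (4c_σ/ℓ)²·#shell`, `|∇G|² ≤ 3(16C_σ/ℓ)² N_P`, `‖∇G·∇Ψ‖² ≤ |∇G|² Σ_{p∈P}|∇_pΨ|²`, `|ΔG| ≤ 3(2C₂/ℓ²) N_P`)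
and the three local statistics I1 (shell mass `≥ c₁ρℓ³`), I2 (`∫ N_P k_P ≤ Cρ³ℓ⁶`), I3 (`⟨N_P²⟩ ≤ Cρ²ℓ⁶`) gives
`Var ≥ (16c_σ²c₁ρ)² / (2√(768C_σ²C₂'ρ³)·ℓ + √(36C₂²C₃ρ²))²` and `ℓ = L/2^k < 2^(m+1)/√ρ` in the window `K ≤ k + m`.
The statements `ShellFloorP`, `PairMixedMomentP`, `PairSecondMomentP`, `StubNearPivot` (and the abbreviations they
use) are VERBATIM copies of the registered skeleton `Cruxes/FluctuationFloor/Lines/…kinematic….lean`. -/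

noncomputable section

namespace Summit.AtomisticToContinuum.BoseEinsteinCondensation.Theorems.NumberPhaseSandwichNearPivotFloor

open Literature.MathematicalPhysics.QuantumManyBody.BoseGas hiding gradSq
open MeasureTheory Set Filter
open Summit.AtomisticToContinuum.BoseEinsteinCondensation.Theorems.NumberPhaseSandwichBumpCalculus
open scoped ENNReal NNReal
open Summit.AtomisticToContinuum.BoseEinsteinCondensation.Theorems.NumberPhaseSandwichBumpProfile
open Summit.AtomisticToContinuum.BoseEinsteinCondensation.Theorems.NumberPhaseSandwichBumpNBody
open Summit.AtomisticToContinuum.BoseEinsteinCondensation.Theorems.NumberPhaseSandwichKinematicCalculus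
open Summit.AtomisticToContinuum.BoseEinsteinCondensation.Theorems.NumberPhaseSandwichNearPivotCompare

variable {N M : ℕ} {L ℓ : ℝ}

/-! ## The registered statements (VERBATIM from the skeleton of stmt-AtomisticToContinuum-32638) -/

/-- verbatim skeleton object: number variance of the dressed pair generator. -/
abbrev Var (ρ : ℝ) (N k : ℕ) (c c' : SubIdx (2 ^ k)) (Ψ : Config N → ℂ) : ENNReal :=
  ⨅ m : ℂ, ∫⁻ X : Config N, (‖(∑ p : Fin N, (((bump (sideLength ρ N / 2 ^ k) c (X p)) -
    (bump (sideLength ρ N / 2 ^ k) c' (X p)) : ℝ) : ℂ)) - m‖₊ : ENNReal) ^ 2 * (‖Ψ X‖₊ : ENNReal) ^ 2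

/-- verbatim skeleton object. -/
abbrev Sib {m : ℕ} (c c' : SubIdx m) : Prop := ∀ j : Fin 3, (c j : ℕ) / 2 = (c' j : ℕ) / 2

/-- verbatim skeleton object. -/
abbrev IntP (k : ℕ) (c : SubIdx (2 ^ k)) : Prop := ∀ j : Fin 3, 1 ≤ (c j : ℕ) / 2 ∧ (c j : ℕ) / 2 + 2 ≤ 2 ^ (k - 1)

/-- verbatim skeleton object. -/
abbrev pairCount (ρ : ℝ) (N k : ℕ) (c c' : SubIdx (2 ^ k)) (X : Config N) : ENNReal :=
  ∑ p : Fin N, (subCell (sideLength ρ N / 2 ^ k) c ∪ subCell (sideLength ρ N / 2 ^ k) c').indicator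
    (fun _ => (1 : ENNReal)) (X p)

/-- verbatim skeleton object. -/
abbrev pairKin (ρ : ℝ) (N k : ℕ) (c c' : SubIdx (2 ^ k)) (Ψ : Config N → ℂ) (X : Config N) : ENNReal :=
  ∑ p : Fin N, (subCell (sideLength ρ N / 2 ^ k) c ∪ subCell (sideLength ρ N / 2 ^ k) c').indicator
    (fun _ => (1 : ENNReal)) (X p) *
    ∑ j : Fin 3, (‖fderiv ℝ Ψ X (Pi.single p (EuclideanSpace.single j (1 : ℝ)))‖₊ : ENNReal) ^ 2

/-- I1 (verbatim skeleton statement `ShellFloorP`). -/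
def ShellFloorP : Prop :=
  ∀ v : ℝ → ENNReal, IsRepulsiveFiniteRange v → ∃ ρ₀ : ℝ, 0 < ρ₀ ∧ ∀ ρ : ℝ, 0 < ρ → ρ < ρ₀ →
    ∀ m : ℕ, ∃ c₁ : ℝ, 0 < c₁ ∧ ∃ c₀ : ℝ, 0 < c₀ ∧ ∀ᶠ N : ℕ in Filter.atTop, ∃ δ : ENNReal, 0 < δ ∧
      ∀ Ψ : TrialState N (sideLength ρ N), energy v Ψ ≤ groundStateEnergy v N (sideLength ρ N) + δ →
        ENNReal.ofReal (c₀ * N) ≤ maxOccupation N Ψ.ψ ∨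
          ∀ K k : ℕ, 1 / Real.sqrt ρ ≤ sideLength ρ N / 2 ^ K → sideLength ρ N / 2 ^ K < 2 * (1 / Real.sqrt ρ) →
            1 ≤ k → k ≤ K → K ≤ k + m →
            ∀ c : SubIdx (2 ^ k), IntP k c →
              ENNReal.ofReal (c₁ * ρ * (sideLength ρ N / 2 ^ k) ^ 3) ≤
                ∫⁻ x in shell (sideLength ρ N / 2 ^ k) c, oneParticleDensity N Ψ.ψ x

/-- I2 (verbatim skeleton statement `PairMixedMomentP`). -/
def PairMixedMomentP : Prop :=
  ∀ v : ℝ → ENNReal, IsRepulsiveFiniteRange v → ∃ ρ₀ : ℝ, 0 < ρ₀ ∧ ∀ ρ : ℝ, 0 < ρ → ρ < ρ₀ →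
    ∀ m : ℕ, ∃ C : ℝ, 0 < C ∧ ∃ c₀ : ℝ, 0 < c₀ ∧ ∀ᶠ N : ℕ in Filter.atTop, ∃ δ : ENNReal, 0 < δ ∧
      ∀ Ψ : TrialState N (sideLength ρ N), energy v Ψ ≤ groundStateEnergy v N (sideLength ρ N) + δ →
        ENNReal.ofReal (c₀ * N) ≤ maxOccupation N Ψ.ψ ∨
          ∀ K k : ℕ, 1 / Real.sqrt ρ ≤ sideLength ρ N / 2 ^ K → sideLength ρ N / 2 ^ K < 2 * (1 / Real.sqrt ρ) →
            1 ≤ k → k ≤ K → K ≤ k + m →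
            ∀ c c' : SubIdx (2 ^ k), c ≠ c' → Sib c c' → IntP k c →
              ∫⁻ X, pairCount ρ N k c c' X * pairKin ρ N k c c' Ψ.ψ X ≤
                ENNReal.ofReal (C * ρ ^ 3 * (sideLength ρ N / 2 ^ k) ^ 6)

/-- I3 (verbatim skeleton statement `PairSecondMomentP`). -/
def PairSecondMomentP : Prop :=
  ∀ v : ℝ → ENNReal, IsRepulsiveFiniteRange v → ∃ ρ₀ : ℝ, 0 < ρ₀ ∧ ∀ ρ : ℝ, 0 < ρ → ρ < ρ₀ →
    ∀ m : ℕ, ∃ C : ℝ, 0 < C ∧ ∃ c₀ : ℝ, 0 < c₀ ∧ ∀ᶠ N : ℕ in Filter.atTop, ∃ δ : ENNReal, 0 < δ ∧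
      ∀ Ψ : TrialState N (sideLength ρ N), energy v Ψ ≤ groundStateEnergy v N (sideLength ρ N) + δ →
        ENNReal.ofReal (c₀ * N) ≤ maxOccupation N Ψ.ψ ∨
          ∀ K k : ℕ, 1 / Real.sqrt ρ ≤ sideLength ρ N / 2 ^ K → sideLength ρ N / 2 ^ K < 2 * (1 / Real.sqrt ρ) →
            1 ≤ k → k ≤ K → K ≤ k + m →
            ∀ c c' : SubIdx (2 ^ k), c ≠ c' → Sib c c' → IntP k c →
              ∫⁻ X, pairCount ρ N k c c' X ^ 2 * (‖Ψ.ψ X‖₊ : ENNReal) ^ 2 ≤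
                ENNReal.ofReal (C * ρ ^ 2 * (sideLength ρ N / 2 ^ k) ^ 6)

/-- STUB A (verbatim skeleton statement `StubNearPivot`). -/
def StubNearPivot : Prop :=
  ∀ v : ℝ → ENNReal, IsRepulsiveFiniteRange v → ∃ ρ₀ : ℝ, 0 < ρ₀ ∧ ∀ ρ : ℝ, 0 < ρ → ρ < ρ₀ →
    ∀ m : ℕ, ∃ c₁ : ℝ, 0 < c₁ ∧ ∃ c₀ : ℝ, 0 < c₀ ∧ ∀ᶠ N : ℕ in Filter.atTop, ∃ δ : ENNReal, 0 < δ ∧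
      ∀ Ψ : TrialState N (sideLength ρ N), energy v Ψ ≤ groundStateEnergy v N (sideLength ρ N) + δ →
        ENNReal.ofReal (c₀ * N) ≤ maxOccupation N Ψ.ψ ∨
          ∀ K k : ℕ, 1 / Real.sqrt ρ ≤ sideLength ρ N / 2 ^ K → sideLength ρ N / 2 ^ K < 2 * (1 / Real.sqrt ρ) →
            1 ≤ k → k ≤ K → K ≤ k + m →
            ∀ c c' : SubIdx (2 ^ k), c ≠ c' → Sib c c' → IntP k c →
              ENNReal.ofReal c₁ ≤ Var ρ N k c c' Ψ.ψ

/-- `Var` is the number variance of `G = Σ_p (h_c − h_c')(x_p)`. -/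
theorem Var_eq (ρ : ℝ) (N k : ℕ) (c c' : SubIdx (2 ^ k)) (Ψ : Config N → ℂ) :
    Var ρ N k c c' Ψ = ⨅ m : ℂ, ∫⁻ X, (‖(G (gpair (sideLength ρ N / 2 ^ k) c c') X : ℂ) - m‖₊ : ℝ≥0∞) ^ 2 *
      (‖Ψ X‖₊ : ℝ≥0∞) ^ 2 := by
  have hG : ∀ X : Config N, (∑ p : Fin N, (((bump (sideLength ρ N / 2 ^ k) c (X p)) -
      (bump (sideLength ρ N / 2 ^ k) c' (X p)) : ℝ) : ℂ)) = ((G (gpair (sideLength ρ N / 2 ^ k) c c') X : ℝ) : ℂ) := by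
    intro X; rw [G, Complex.ofReal_sum]
  simp only [Var, hG]

/-- ONE CELL PAIR: the floor from the three local statistics. -/
theorem floor_pair {ρ : ℝ} (hρ : 0 < ρ) {N k : ℕ} (Ψ : TrialState (N + 1) (sideLength ρ (N + 1)))
    (c c' : SubIdx (2 ^ k)) (hcc : c ≠ c') {cσ Cσ C₂ a₁ A₂ A₃ B : ℝ} (hcσ : 0 < cσ)
    (hcσb : ∀ x ∈ Icc (1 / 4 : ℝ) (3 / 4), cσ ≤ sigmaDeriv x) (hCσb : ∀ x : ℝ, |sigmaDeriv x| ≤ Cσ)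
    (hC₂ : 0 < C₂) (hC₂b : ∀ t : ℝ, |deriv tauDeriv t| ≤ C₂) (ha₁ : 0 < a₁) (hA₂ : 0 < A₂) (hA₃ : 0 < A₃)
    (hℓB : sideLength ρ (N + 1) / 2 ^ k ≤ B)
    (I1 : ENNReal.ofReal (a₁ * ρ * (sideLength ρ (N + 1) / 2 ^ k) ^ 3) ≤
      ∫⁻ x in shell (sideLength ρ (N + 1) / 2 ^ k) c, oneParticleDensity (N + 1) Ψ.ψ x)
    (I2 : ∫⁻ X, pairCount ρ (N + 1) k c c' X * pairKin ρ (N + 1) k c c' Ψ.ψ X ≤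
      ENNReal.ofReal (A₂ * ρ ^ 3 * (sideLength ρ (N + 1) / 2 ^ k) ^ 6))
    (I3 : ∫⁻ X, pairCount ρ (N + 1) k c c' X ^ 2 * (‖Ψ.ψ X‖₊ : ENNReal) ^ 2 ≤
      ENNReal.ofReal (A₃ * ρ ^ 2 * (sideLength ρ (N + 1) / 2 ^ k) ^ 6)) :
    ENNReal.ofReal ((16 * cσ ^ 2 * a₁ * ρ) ^ 2 /
        (2 * Real.sqrt (768 * Cσ ^ 2 * A₂ * ρ ^ 3) * B + Real.sqrt (36 * C₂ ^ 2 * A₃ * ρ ^ 2)) ^ 2) ≤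
      Var ρ (N + 1) k c c' Ψ.ψ := by
  set ℓ : ℝ := sideLength ρ (N + 1) / 2 ^ k with hℓdef
  have hL : 0 < sideLength ρ (N + 1) := sideLength_pos_of_pos hρ (Nat.succ_pos N)
  have hℓ : 0 < ℓ := by positivity
  -- A
  have hA : ENNReal.ofReal ((16 * cσ ^ 2 * a₁ * ρ) * ℓ) ≤
      ENNReal.ofReal (∫ X, gradSq (gpair ℓ c c') X * ‖Ψ.ψ X‖ ^ 2) := by
    have h := A_ge Ψ c c' hℓ hcσ.le hcσb hcc
    rw [lintegral_shellCount_eq Ψ (measurableSet_shell ℓ c)] at h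
    refine le_trans ?_ h
    have key : (16 * cσ ^ 2 * a₁ * ρ) * ℓ = (4 * cσ / ℓ) ^ 2 * (a₁ * ρ * ℓ ^ 3) := by
      field_simp; ring
    rw [key, ENNReal.ofReal_mul (p := (4 * cσ / ℓ) ^ 2) (q := a₁ * ρ * ℓ ^ 3) (by positivity)]
    exact mul_le_mul' le_rfl I1
  -- T
  have hT : ENNReal.ofReal (∫ X, ‖DPsi (gpair ℓ c c') Ψ.ψ X‖ ^ 2) ≤
      ENNReal.ofReal ((768 * Cσ ^ 2 * A₂ * ρ ^ 3) * ℓ ^ 4) := by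
    refine (T_le Ψ c c' hℓ hCσb).trans ?_
    have key : (768 * Cσ ^ 2 * A₂ * ρ ^ 3) * ℓ ^ 4 = (3 * (16 * Cσ / ℓ) ^ 2) * (A₂ * ρ ^ 3 * ℓ ^ 6) := by
      field_simp; ring
    rw [key, ENNReal.ofReal_mul (p := 3 * (16 * Cσ / ℓ) ^ 2) (q := A₂ * ρ ^ 3 * ℓ ^ 6) (by positivity)]
    exact mul_le_mul' le_rfl I2
  -- C
  have hC : ENNReal.ofReal (∫ X, lapG (gpair ℓ c c') X ^ 2 * ‖Ψ.ψ X‖ ^ 2) ≤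
      ENNReal.ofReal ((36 * C₂ ^ 2 * A₃ * ρ ^ 2) * ℓ ^ 2) := by
    refine (C_le Ψ c c' hℓ hC₂b).trans ?_
    have key : (36 * C₂ ^ 2 * A₃ * ρ ^ 2) * ℓ ^ 2 = (3 * (2 * C₂ / ℓ ^ 2)) ^ 2 * (A₃ * ρ ^ 2 * ℓ ^ 6) := by
      field_simp; ring
    rw [key, ENNReal.ofReal_mul (p := (3 * (2 * C₂ / ℓ ^ 2)) ^ 2) (q := A₃ * ρ ^ 2 * ℓ ^ 6) (by positivity)]
    exact mul_le_mul' le_rfl I3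
  have hcore := floor_core Ψ c c' (by positivity) (by positivity) (by positivity) hA hT hC
  rw [Var_eq]
  refine le_trans (ENNReal.ofReal_le_ofReal ?_) hcore
  exact const_arith (κA := 16 * cσ ^ 2 * a₁ * ρ) (by positivity) (by positivity) hℓ hℓB

/-- **The registered stub, proved**: near-pivot floor from the three local statistics. -/
theorem stub_nearPivot_of_kinematic : ShellFloorP → PairMixedMomentP → PairSecondMomentP → StubNearPivot := by
  intro h1 h2 h3 v hv
  obtain ⟨ρ₁, hρ₁, H₁⟩ := h1 v hv
  obtain ⟨ρ₂, hρ₂, H₂⟩ := h2 v hv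
  obtain ⟨ρ₃, hρ₃, H₃⟩ := h3 v hv
  refine ⟨min ρ₁ (min ρ₂ ρ₃), lt_min hρ₁ (lt_min hρ₂ hρ₃), fun ρ hρ hρlt m => ?_⟩
  have hρ1 : ρ < ρ₁ := lt_of_lt_of_le hρlt (min_le_left _ _)
  have hρ2 : ρ < ρ₂ := lt_of_lt_of_le hρlt ((min_le_right _ _).trans (min_le_left _ _))
  have hρ3 : ρ < ρ₃ := lt_of_lt_of_le hρlt ((min_le_right _ _).trans (min_le_right _ _))
  obtain ⟨a₁, ha₁, e₁, he₁, E₁⟩ := H₁ ρ hρ hρ1 m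
  obtain ⟨A₂, hA₂, e₂, he₂, E₂⟩ := H₂ ρ hρ hρ2 m
  obtain ⟨A₃, hA₃, e₃, he₃, E₃⟩ := H₃ ρ hρ hρ3 m
  obtain ⟨cσ, hcσ, hcσb⟩ := exists_sigmaDeriv_lower
  obtain ⟨Cσ, hCσ, hCσb⟩ := exists_sigmaDeriv_upper
  obtain ⟨C₂, hC₂, hC₂b⟩ := exists_deriv_tauDeriv_upper
  have hsqC : 0 < Real.sqrt (36 * C₂ ^ 2 * A₃ * ρ ^ 2) := Real.sqrt_pos.2 (by positivity)
  refine ⟨(16 * cσ ^ 2 * a₁ * ρ) ^ 2 / (2 * Real.sqrt (768 * Cσ ^ 2 * A₂ * ρ ^ 3) * (2 ^ (m + 1) * (1 / Real.sqrt ρ)) +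
      Real.sqrt (36 * C₂ ^ 2 * A₃ * ρ ^ 2)) ^ 2, by positivity, min e₁ (min e₂ e₃), lt_min he₁ (lt_min he₂ he₃), ?_⟩
  filter_upwards [E₁, E₂, E₃, Filter.eventually_ge_atTop 1] with N hN₁ hN₂ hN₃ hN1
  obtain ⟨δ₁, hδ₁, F₁⟩ := hN₁
  obtain ⟨δ₂, hδ₂, F₂⟩ := hN₂
  obtain ⟨δ₃, hδ₃, F₃⟩ := hN₃
  refine ⟨min δ₁ (min δ₂ δ₃), lt_min hδ₁ (lt_min hδ₂ hδ₃), fun Ψ hΨ => ?_⟩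
  have hΨ1 : energy v Ψ ≤ groundStateEnergy v N (sideLength ρ N) + δ₁ :=
    hΨ.trans (add_le_add le_rfl (min_le_left _ _))
  have hΨ2 : energy v Ψ ≤ groundStateEnergy v N (sideLength ρ N) + δ₂ :=
    hΨ.trans (add_le_add le_rfl ((min_le_right _ _).trans (min_le_left _ _)))
  have hΨ3 : energy v Ψ ≤ groundStateEnergy v N (sideLength ρ N) + δ₃ :=
    hΨ.trans (add_le_add le_rfl ((min_le_right _ _).trans (min_le_right _ _)))
  have hmono : ∀ e : ℝ, min e₁ (min e₂ e₃) ≤ e → ENNReal.ofReal (e * N) ≤ maxOccupation N Ψ.ψ →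
      ENNReal.ofReal (min e₁ (min e₂ e₃) * N) ≤ maxOccupation N Ψ.ψ := fun e he h =>
    (ENNReal.ofReal_le_ofReal (mul_le_mul_of_nonneg_right he N.cast_nonneg)).trans h
  rcases F₁ Ψ hΨ1 with h | G₁
  · exact Or.inl (hmono e₁ (min_le_left _ _) h)
  rcases F₂ Ψ hΨ2 with h | G₂
  · exact Or.inl (hmono e₂ ((min_le_right _ _).trans (min_le_left _ _)) h)
  rcases F₃ Ψ hΨ3 with h | G₃
  · exact Or.inl (hmono e₃ ((min_le_right _ _).trans (min_le_right _ _)) h)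
  refine Or.inr fun K k hK1 hK2 hk1 hkK hKkm c c' hcc hsib hint => ?_
  have I1 := G₁ K k hK1 hK2 hk1 hkK hKkm c hint
  have I2 := G₂ K k hK1 hK2 hk1 hkK hKkm c c' hcc hsib hint
  have I3 := G₃ K k hK1 hK2 hk1 hkK hKkm c c' hcc hsib hint
  obtain ⟨N', rfl⟩ : ∃ N', N = N' + 1 := ⟨N - 1, by omega⟩
  have hL : 0 ≤ sideLength ρ (N' + 1) := (sideLength_pos_of_pos hρ (Nat.succ_pos N')).le
  exact floor_pair hρ Ψ c c' hcc hcσ hcσb hCσb hC₂ hC₂b ha₁ hA₂ hA₃ (ell_le_window hL hK2 hkK hKkm) I1 I2 I3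


end Summit.AtomisticToContinuum.BoseEinsteinCondensation.Theorems.NumberPhaseSandwichNearPivotFloor

end
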